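import Mathlib
import Summits.ResolutionOfSingularities.ResolutionOfSingularities.Theorems.WeightedInvariantLocalWeightedDropNCResSurfGraphMonomial
import Summits.ResolutionOfSingularities.ResolutionOfSingularities.Theorems.WeightedInvariantLocalWeightedDropNCResSurfGraphEndgameComb

/-!
# `WeightedInvariant.LocalWeightedDrop`: NC-resolution settings for the TOT₂ line — GRAPH SURFACES, part 25: THE SUCCESSORS OF A MONOMIAL STATE AND THEIR EXPONENT MULTISETS

Crux item stmt-ResolutionOfSingularities-8899 `LocalWeightedDrop` (route `ResolutionOfSingularities/WeightedInvariant`), ENGINE skeleton v34/v35, residual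
`stub_wildWideApexFourStartsWon`; res-L1-w43-strat-1's line `directrix-cut` v3f, piece PL₃, sub-skeleton `pl3_split_v1` (7519a9009475ab47), stub
`stub_apexPlaneSurfaceThree` = the SURFACE sub-case `ApexPlaneSurfaceExit`, reduced (…NCResSurfGraphRegime, p557720) to the loop `SurfLoop k m`.
Design memo `L/res-L1-w43-stub-4/g6/SURFLOOP-DESIGN.md`.  [OURS · L1 W4.3 · chain w43 · seat res-L1-w43-stub-4 gen 6; def-free, on parts 1–19 and 22
(…NCResSurfGraph*), res-L1-w43-stub-1's S-SET and res-L1-w43-lead-1's boundary bookkeeping (…NCResRegimeTransport); the count game is the programme's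
own; nothing here is a statement of any manuscript; AI-produced, gate-checked, weaker than expert review.]

* `expMultiset_transport` — the exponent multiset through a move whose successor letters are the re-indexed letters through the answer;
* `exists_table_pointSucc` / `exists_table_curveSucc` — the successor of the point move read at `a` (resp. of the curve move) of a monomial state is
  monomial, with exponent multiset `Endgame.moveA`/`moveG` (resp. `moveC₁`) of the combinatorial game (part 22);
* `moveA_map_swap`, `moveC₁_map_swap`, `C₁Avail_map_swap` — the swapped reading realises `moveB`, `moveC₂`.
-/

set_option linter.dupNamespace false -- mandated namespace of this single-conjunct summit

noncomputable section

namespace Summit.ResolutionOfSingularities.ResolutionOfSingularities.Theorems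

namespace TameFourTupleDrop

namespace GraphSurf

namespace SurfDatum

open MvPowerSeries Literature.AlgebraicGeometry.Resolution

variable {k : Type} [Field k] {m : ℕ}

open Classical in
/-- TRANSPORT OF THE EXPONENT MULTISET through a move whose successor letters are the re-indexed letters through the answer. -/
theorem expMultiset_transport {σ σ' : SurfDatum k m} {e e' : Fin (m + 1) → ℕ × ℕ} {c : Fin (m + 1) → k}
    (hoff : σ'.off = (σ.off.filter fun l => c l = 0).image fun l => Fin.predAbove σ.a l.succ)
    (hzero : ∀ l ∈ σ.off, c l = 0 → (σ'.ψ (Fin.predAbove σ.a l.succ) = 0 ↔ σ.ψ l = 0))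
    (keep : ℕ × ℕ → Prop) [DecidablePred keep] (T : ℕ × ℕ → ℕ × ℕ)
    (hkeep : ∀ l ∈ σ.off, σ.ψ l ≠ 0 → (c l = 0 ↔ keep (e l)))
    (hT : ∀ l ∈ σ.off, σ.ψ l ≠ 0 → c l = 0 → e' (Fin.predAbove σ.a l.succ) = T (e l)) :
    σ'.expMultiset e' = ((σ.expMultiset e).filter keep).map T := by
  have hinj : Set.InjOn (fun l : Fin (m + 1) => Fin.predAbove σ.a l.succ) (σ.off : Set (Fin (m + 1))) := by
    intro l hl l' hl' h
    exact predAbove_succ_injOn (fun h' => ((mem_off_iff σ l).mp hl).2 (Or.inl h')) (fun h' => ((mem_off_iff σ l').mp hl').2 (Or.inl h')) h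
  set S := σ.off.filter fun l => c l = 0 ∧ σ.ψ l ≠ 0 with hS
  have hS' : (σ'.off.filter fun l' => σ'.ψ l' ≠ 0) = S.image fun l => Fin.predAbove σ.a l.succ := by
    rw [hoff, Finset.filter_image, Finset.filter_filter]
    congr 1
    refine Finset.filter_congr fun l hl => ?_
    constructor
    · rintro ⟨hc, hne⟩
      exact ⟨hc, fun h0 => hne ((hzero l hl hc).mpr h0)⟩
    · rintro ⟨hc, hne⟩
      exact ⟨hc, fun h0 => hne ((hzero l hl hc).mp h0)⟩
  have hS2 : ((σ.off.filter fun l => σ.ψ l ≠ 0).filter (keep ∘ e)) = S := by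
    rw [Finset.filter_filter]
    refine Finset.filter_congr fun l hl => ?_
    simp only [Function.comp]
    constructor
    · rintro ⟨hne, hk⟩
      exact ⟨(hkeep l hl hne).mpr hk, hne⟩
    · rintro ⟨hc, hne⟩
      exact ⟨hne, (hkeep l hl hne).mp hc⟩
  rw [expMultiset, expMultiset, hS', Finset.image_val_of_injOn (hinj.mono (by intro l hl; exact (Finset.mem_filter.mp hl).1)),
    Multiset.map_map, Multiset.filter_map, ← Finset.filter_val, hS2, Multiset.map_map]
  refine Multiset.map_congr rfl fun l hl => ?_
  obtain ⟨hlo, hc, hne⟩ := Finset.mem_filter.mp hl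
  exact hT l hlo hne hc

/-- In a monomial state the exponents of a non-zero trace are the table's, and are not both zero. -/
theorem IsMonomial.eq_of_ne_zero {σ : SurfDatum k m} {e : Fin (m + 1) → ℕ × ℕ} (h : σ.IsMonomial e) (hσ : σ.Valid)
    {l : Fin (m + 1)} (hl : l ∈ σ.off) (hne : σ.ψ l ≠ 0) :
    ∃ u : MvPowerSeries (Fin 2) k, constantCoeff u ≠ 0 ∧ σ.ψ l = u * X 0 ^ (e l).1 * X 1 ^ (e l).2 ∧ ¬ ((e l).1 = 0 ∧ (e l).2 = 0) := by
  rcases h l hl with h0 | ⟨u, hu, he⟩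
  · exact absurd h0 hne
  · refine ⟨u, hu, he, exps_ne_zero_of_constantCoeff hu ?_⟩
    rw [← he]
    exact hσ.2.2.1 l ((mem_off_iff σ l).mp hl).2

/-- The exponent multiset of a monomial state has no `(0,0)`. -/
theorem expMultiset_ne_zero_zero {σ : SurfDatum k m} {e : Fin (m + 1) → ℕ × ℕ} (h : σ.IsMonomial e) (hσ : σ.Valid) :
    ∀ x ∈ σ.expMultiset e, x ≠ (0, 0) := by
  classical
  intro x hx
  rw [expMultiset, Multiset.mem_map] at hx
  obtain ⟨l, hl, rfl⟩ := hx
  obtain ⟨hlo, hne⟩ := Finset.mem_filter.mp hl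
  obtain ⟨u, hu, he, hpq⟩ := h.eq_of_ne_zero hσ hlo hne
  intro h0
  exact hpq ⟨by rw [h0], by rw [h0]⟩

open Classical in
/-- Membership in the exponent multiset. -/
theorem mem_expMultiset_iff {σ : SurfDatum k m} {e : Fin (m + 1) → ℕ × ℕ} {x : ℕ × ℕ} :
    x ∈ σ.expMultiset e ↔ ∃ l ∈ σ.off, σ.ψ l ≠ 0 ∧ e l = x := by
  rw [expMultiset, Multiset.mem_map]
  constructor
  · rintro ⟨l, hl, he⟩
    obtain ⟨hlo, hne⟩ := Finset.mem_filter.mp hl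
    exact ⟨l, hlo, hne, he⟩
  · rintro ⟨l, hlo, hne, he⟩
    exact ⟨l, Finset.mem_filter.mpr ⟨hlo, hne⟩, he⟩

/-! ### Successor tables -/

open Classical in
/-- The successor of the POINT MOVE READ AT `a` of a monomial state is monomial, with exponent multiset `moveA` (`μ = 0`) resp. `moveG` (`μ ≠ 0`). -/
theorem exists_table_pointSucc {σ : SurfDatum k m} (hσ : σ.Valid) {e : Fin (m + 1) → ℕ × ℕ} (hmono : σ.IsMonomial e) {c : Fin (m + 1) → k}
    (hc : c = c σ.a • tangentL σ.a σ.b σ.ψ + c σ.b • tangentR σ.a σ.b σ.ψ) (hca : c σ.a ≠ 0) (G : MvPowerSeries (Fin (m + 1 + 1)) k) :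
    ∃ e' : Fin (m + 1) → ℕ × ℕ, (σ.pointSucc c G).IsMonomial e' ∧
      (σ.pointSucc c G).expMultiset e' = if c σ.b = 0 then Endgame.moveA (σ.expMultiset e) else Endgame.moveG (σ.expMultiset e) := by
  classical
  have hab := hσ.2.1
  -- the table: at the re-indexed letter `l⁺ = (q : Fin m).succ` (`l = a.succAbove q`) the moved exponents of `l`
  set T : ℕ × ℕ → ℕ × ℕ := fun x => if c σ.b = 0 then Endgame.stepA x else Endgame.stepG x with hT
  set e' : Fin (m + 1) → ℕ × ℕ := fun l' => if h : l' = 0 then (0, 0) else T (e (σ.a.succAbove (l'.pred h))) with he'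
  have he'val : ∀ l, l ≠ σ.a → e' (Fin.predAbove σ.a l.succ) = T (e l) := by
    intro l hl
    obtain ⟨q, rfl, hq⟩ := predAbove_succ_eq hl
    rw [hq, he']
    simp only [Fin.succ_ne_zero, ↓reduceDIte, Fin.pred_succ]
  have hzero : ∀ l ∈ σ.off, c l = 0 → ((σ.pointSucc c G).ψ (Fin.predAbove σ.a l.succ) = 0 ↔ σ.ψ l = 0) := by
    intro l hl hcl
    have hla : l ≠ σ.a := fun h => ((mem_off_iff σ l).mp hl).2 (Or.inl h)
    constructor
    · intro h0
      by_contra hne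
      obtain ⟨u, hu, he, hpq⟩ := hmono.eq_of_ne_zero hσ hl hne
      obtain ⟨u', hu', he''⟩ := pointSucc_ψ_monomial hca G hla hcl hu hpq he
      rw [he''] at h0
      exact (mul_ne_zero (mul_ne_zero (fun h => hu' (by rw [h, map_zero])) (pow_ne_zero _ (FormalCoordChange.X_ne_zero' _)))
        (pow_ne_zero _ (FormalCoordChange.X_ne_zero' _))) h0
    · intro h0
      exact pointSucc_ψ_eq_zero G hla h0 hcl
  refine ⟨e', ?_, ?_⟩
  · -- monomial
    intro l' hl'
    obtain ⟨l, hl, hcl, rfl⟩ := (mem_off_pointSucc_iff hab hca G l').mp hl'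
    have hla : l ≠ σ.a := fun h => ((mem_off_iff σ l).mp hl).2 (Or.inl h)
    by_cases h0 : σ.ψ l = 0
    · exact Or.inl (pointSucc_ψ_eq_zero G hla h0 hcl)
    · obtain ⟨u, hu, he, hpq⟩ := hmono.eq_of_ne_zero hσ hl h0
      obtain ⟨u', hu', he''⟩ := pointSucc_ψ_monomial hca G hla hcl hu hpq he
      refine Or.inr ⟨u', hu', ?_⟩
      rw [he'', he'val l hla, hT]
      by_cases hμ : c σ.b = 0
      · simp [hμ, Endgame.stepA]
      · simp [hμ, Endgame.stepG]
  · -- multiset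
    by_cases hμ : c σ.b = 0
    · rw [if_pos hμ, Endgame.moveA]
      refine expMultiset_transport (off_pointSucc_eq_image hab hca G) hzero (fun x => x ≠ (1, 0)) Endgame.stepA
        (fun l hl hne => ?_) (fun l hl hne _ => ?_)
      · obtain ⟨u, hu, he, hpq⟩ := hmono.eq_of_ne_zero hσ hl hne
        rw [point_answer_eq_zero_iff hc hca hl hu hpq he, ne_eq, Prod.ext_iff]
        simp only [hμ, true_or, and_true]
      · rw [he'val l (fun h => ((mem_off_iff σ l).mp hl).2 (Or.inl h)), hT]
        simp only [hμ, ↓reduceIte]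
    · rw [if_neg hμ, Endgame.moveG]
      refine expMultiset_transport (off_pointSucc_eq_image hab hca G) hzero (fun x => x ≠ (1, 0) ∧ x ≠ (0, 1)) Endgame.stepG
        (fun l hl hne => ?_) (fun l hl hne _ => ?_)
      · obtain ⟨u, hu, he, hpq⟩ := hmono.eq_of_ne_zero hσ hl hne
        rw [point_answer_eq_zero_iff hc hca hl hu hpq he, ne_eq, ne_eq, Prod.ext_iff, Prod.ext_iff]
        simp only [hμ, false_or]
      · rw [he'val l (fun h => ((mem_off_iff σ l).mp hl).2 (Or.inl h)), hT]
        simp only [hμ, ↓reduceIte]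

/-- The successor of the CURVE MOVE of a monomial state with every `p ≥ 1` is monomial, with exponent multiset `moveC₁`. -/
theorem exists_table_curveSucc {σ : SurfDatum k m} (hσ : σ.Valid) {e : Fin (m + 1) → ℕ × ℕ} (hmono : σ.IsMonomial e)
    (hC₁ : Endgame.C₁Avail (σ.expMultiset e)) {c : Fin (m + 1) → k}
    (hc : c = c σ.a • tangentL σ.a σ.b (fun j => if j ∈ σ.δ.E then σ.ψ j else 0)) (hca : c σ.a ≠ 0) (G : MvPowerSeries (Fin (m + 1 + 1)) k) :
    ∃ e' : Fin (m + 1) → ℕ × ℕ, (σ.curveSucc c G).IsMonomial e' ∧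
      (σ.curveSucc c G).expMultiset e' = Endgame.moveC₁ (σ.expMultiset e) := by
  classical
  have hab := hσ.2.1
  have hp : ∀ l ∈ σ.off, σ.ψ l ≠ 0 → 1 ≤ (e l).1 := fun l hl hne =>
    hC₁ (e l) (mem_expMultiset_iff.mpr ⟨l, hl, hne, rfl⟩)
  set e' : Fin (m + 1) → ℕ × ℕ := fun l' => if h : l' = 0 then (0, 0) else Endgame.stepC₁ (e (σ.a.succAbove (l'.pred h))) with he'
  have he'val : ∀ l, l ≠ σ.a → e' (Fin.predAbove σ.a l.succ) = Endgame.stepC₁ (e l) := by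
    intro l hl
    obtain ⟨q, rfl, hq⟩ := predAbove_succ_eq hl
    rw [hq, he']
    simp only [Fin.succ_ne_zero, ↓reduceDIte, Fin.pred_succ]
  have hzero : ∀ l ∈ σ.off, c l = 0 → ((σ.curveSucc c G).ψ (Fin.predAbove σ.a l.succ) = 0 ↔ σ.ψ l = 0) := by
    intro l hl hcl
    constructor
    · intro h0
      by_contra hne
      obtain ⟨u, hu, he, -⟩ := hmono.eq_of_ne_zero hσ hl hne
      obtain ⟨u', hu', he''⟩ := curveSucc_ψ_monomial hca G hl hcl hu (hp l hl hne) he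
      rw [he''] at h0
      exact (mul_ne_zero (mul_ne_zero (fun h => hu' (by rw [h, map_zero])) (pow_ne_zero _ (FormalCoordChange.X_ne_zero' _)))
        (pow_ne_zero _ (FormalCoordChange.X_ne_zero' _))) h0
    · intro h0
      exact curveSucc_ψ_eq_zero G hl h0 hcl
  refine ⟨e', ?_, ?_⟩
  · intro l' hl'
    obtain ⟨l, hl, hcl, rfl⟩ := (mem_off_curveSucc_iff hab hca G l').mp hl'
    have hla : l ≠ σ.a := fun h => ((mem_off_iff σ l).mp hl).2 (Or.inl h)
    by_cases h0 : σ.ψ l = 0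
    · exact Or.inl (curveSucc_ψ_eq_zero G hl h0 hcl)
    · obtain ⟨u, hu, he, -⟩ := hmono.eq_of_ne_zero hσ hl h0
      obtain ⟨u', hu', he''⟩ := curveSucc_ψ_monomial hca G hl hcl hu (hp l hl h0) he
      refine Or.inr ⟨u', hu', ?_⟩
      rw [he'', he'val l hla, Endgame.stepC₁]
  · rw [Endgame.moveC₁]
    refine expMultiset_transport (off_curveSucc_eq_image hab hca G) hzero (fun x => x ≠ (1, 0)) Endgame.stepC₁
      (fun l hl hne => ?_) (fun l hl _ _ => he'val l (fun h => ((mem_off_iff σ l).mp hl).2 (Or.inl h)))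
    obtain ⟨u, hu, he, hpq⟩ := hmono.eq_of_ne_zero hσ hl hne
    rw [curve_answer_eq_zero_iff hc hca hl hu hpq he, ne_eq, Prod.ext_iff]

/-! ### The swapped reading in the combinatorial game -/

/-- `moveA` of the swapped multiset is `moveB`. -/
theorem moveA_map_swap (M : Multiset (ℕ × ℕ)) : Endgame.moveA (M.map Prod.swap) = Endgame.moveB M := by
  rw [Endgame.moveA, Endgame.moveB, Multiset.filter_map, Multiset.map_map]
  have hfilt : M.filter ((fun x : ℕ × ℕ => x ≠ (1, 0)) ∘ Prod.swap) = M.filter fun x => x ≠ (0, 1) :=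
    Multiset.filter_congr fun x _ => by
      simp only [Function.comp, ne_eq, Prod.ext_iff, Prod.fst_swap, Prod.snd_swap]
      tauto
  rw [hfilt]
  refine Multiset.map_congr rfl fun x _ => ?_
  simp only [Function.comp, Endgame.stepA, Endgame.stepB, Prod.fst_swap, Prod.snd_swap, Nat.add_comm]

/-- `moveC₁` of the swapped multiset is `moveC₂`. -/
theorem moveC₁_map_swap (M : Multiset (ℕ × ℕ)) : Endgame.moveC₁ (M.map Prod.swap) = Endgame.moveC₂ M := by
  rw [Endgame.moveC₁, Endgame.moveC₂, Multiset.filter_map, Multiset.map_map]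
  have hfilt : M.filter ((fun x : ℕ × ℕ => x ≠ (1, 0)) ∘ Prod.swap) = M.filter fun x => x ≠ (0, 1) :=
    Multiset.filter_congr fun x _ => by
      simp only [Function.comp, ne_eq, Prod.ext_iff, Prod.fst_swap, Prod.snd_swap]
      tauto
  rw [hfilt]
  rfl

/-- `C₁Avail` of the swapped multiset is `C₂Avail`. -/
theorem C₁Avail_map_swap (M : Multiset (ℕ × ℕ)) : Endgame.C₁Avail (M.map Prod.swap) ↔ Endgame.C₂Avail M := by
  simp only [Endgame.C₁Avail, Endgame.C₂Avail, Multiset.mem_map, forall_exists_index, and_imp]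
  constructor
  · intro h x hx
    exact h (Prod.swap x) x hx rfl
  · rintro h _ x hx rfl
    exact h x hx


end SurfDatum

end GraphSurf

end TameFourTupleDrop

end Summit.ResolutionOfSingularities.ResolutionOfSingularities.Theorems

end
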